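import Summits.BirchSwinnertonDyer.BirchSwinnertonDyer.Theorems.GenusKolyvaginAtTwoPowDvdShaCardAtTwoRTLadderFrame
import Summits.BirchSwinnertonDyer.BirchSwinnertonDyer.Theorems.GenusKolyvaginAtTwoPowDvdShaCardAtTwoRTGenusParity
import HarnessLib

/-!
# Route `GenusKolyvaginAtTwo`, LINE 18 `plus_descent` v5 (L_T `PowDvdShaCardAtTwoRT`, stmt-BirchSwinnertonDyer-23242) —
# the DEEP genus regime WITHOUT the cross-side count J: ONE-SIDED exhibition closes every `B`, and the DEFECT-RANK frame

Seat `bsd-line-gk2-p4` g17 (WIDTH-5 attach, cell `bsd-f1-sign2`), `--supports stmt-BirchSwinnertonDyer-23242` (helper; closes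
nothing).  THEOREMS ONLY (no definition, no named fact, no `sorry`); BSD is not proved by any of this; neither is L_T or 3a⁗.

CONTEXT.  Skeleton v5 derives the deep regime (`B := ord₂ C(Wd) ≥ 2`; on `Δ_W < 0`, `B ≥ 3` by GP) of THE crux 3a⁗
(`2·M₀ ≤ ord₂ g + ord₂ g′ + B`) as L (the two `ℚ`-side `Ш`-ladders) + J (`stub_jointGenusCountAtTwo`, a cross-side count).
J is FALSE as typed (gk2-p3 g20, `Cruxes/PowDvdShaCardAtTwoRT/Lines/plus-descent-stubJ-audit.md`: existence-only ladders may be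
FAKED from Kramer's genus classes of order `2`; gk2-p3 g18's two-sided frame `two_mul_le_padicValNat_add_of_shaLadders`, loss
`4⌊B/2⌋`, is sharp for such hypotheses).  This file records the two J-free counts that DO close the deep regime, in the
currency of 3a⁗ and of gk2-p3's frame files (`…RTLadderFrame`, `…RTLadderFrameBookkeeping`, `…RTLadderCountTwin`):

* §1 `two_mul_sum_le_padicValNat_of_ladder_of_sha_le` — gk2-p3's one-sided count with the ambient subgroup made a PARAMETER:
  for `X/ℚ` with `Ш(X/ℚ)[2^∞]` finite and ANY subgroup `Ш(X/ℚ) ≤ R ≤ H¹(ℚ, X)` of finite index `≤ 2^β`, a ladder of independent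
  families INSIDE `R` gives `2 Σ_m e_m ≤ ord₂ #Ш(X/ℚ)[2^∞] + 2⌊β/2⌋`.  With `R := Ш(X/ℚ) ⊔ ⟨ladder⟩`, `β` is the 𝔽₂-RANK OF THE
  LADDER'S GENUS DEFECTS in `res⁻¹Ш(X_K/K)/Ш(X/ℚ) ↪ ⊕_{p ∣ d_K} H¹(Gal(K_𝔓/ℚ_p), X(K_𝔓))` — not the full budget `B`.
* §2 **`two_mul_le_padicValNat_add_of_ladders_of_sha_le` (THE DEFECT-RANK FRAME)** — two curves `W, Wd /ℚ`, two such subgroups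
  `R₊, R₋` of indices `≤ 2^{β₊}, 2^{β₋}`, an antitone ladder `M` with `M (2T) = 0` whose even-step families lie in `R₊` and odd-step
  families in `R₋` ⟹ `2·M₀ ≤ ord₂ g + ord₂ g′ + 2⌊β₊/2⌋ + 2⌊β₋/2⌋`.  So on `B = 3` the registered 3a⁗ follows from L the moment ONE
  side's ladder has defect rank `≤ 1` (no hypothesis on the other side beyond `β ≤ B`): the honest replacement of J is a DEFECT
  statement about the descended Kolyvagin classes, not a count.
* §3 **ONE-SIDED EXHIBITION CLOSES EVERY `B`** (`twinExhibitionGenus_ineq_of_oneSided_shaLadder_W` / `…_Wd`): on the LINE 18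
  frame (`W` globally minimal, `Δ_W < 0`, `C(W)` odd; `K` imaginary quadratic, `d_K` odd, Heegner for `N_W`; `Wd = Cd • W^{(d_K)}`),
  if the WHOLE ladder (antitone `N`, `N T = 0`, at rung `j < T`: `2j+2` independent classes of order `2^{N j − N (j+1)}`) sits in
  `H¹(ℚ, X)` with restrictions in `Ш(X_K/K)` for ONE `X ∈ {W, Wd}`, then `2·N₀ ≤ ord₂ g_X + 2⌊B/2⌋ = ord₂ g_X + B − 1` (`B` odd by
  GP `odd_padicValNat_two_tamagawaProduct_twin_of_Δ_neg`), hence 3a‴'s `2·N₀ ≤ ord₂ g + ord₂ g′ + B − 1` and 3a⁗ a fortiori — the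
  genus budget is paid ONCE and the Milne/Yu refund `+ (B − 1)` of 3b″ covers it exactly.  In L's own two-sided format:
  `twinExhibitionGenus_ineq_of_shaLadders_of_odd_steps_eq` (all odd-step drops `M(2m+1) − M(2m+2) = 0` ⟹ 3a‴) and
  `…_of_even_steps_eq` (all even-step drops `0` ⟹ 3a‴).
  READING (memo `Lines/plus-descent-deep-onesided.md`): a Kolyvagin class of ORDER 2 (`c₁(n) ∈ H¹(K, E[2])`) is `τ`-fixed for
  either sign (`±1` agree mod `2`), so it descends to BOTH `H¹(ℚ, W[2])` and `H¹(ℚ, Wd[2])`: every rung with drop `1` can be put on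
  either side, and §3 closes the deep regime on every row whose drops `≥ 2` all carry one sign (e.g. the pen's three deep
  instrument rows, where `M₀ = 1`).  The residual of the deep regime is «`B ≥ 3` ∧ drops `≥ 2` on BOTH signs».

References: [McCallumLMS1991] §5 Prop. 5.2, Thm. 5.4, p. 310; [Kramer1981] §2 Prop. 3, Thm. 1, §4 (13); [GrossLMS1991] Prop. 5.4, §6;
[SilvermanAEC2009] X.4.14.
-/

set_option autoImplicit false
-- the Theorems namespace of this sub repeats the summit name by design (D-0017 nested layout)
set_option linter.dupNamespace false

noncomputable section

open scoped Classical

namespace Summit.BirchSwinnertonDyer.BirchSwinnertonDyer.Theorems.GenusExact.PlusDescent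

open WeierstrassCurve NumberField Literature.NumberTheory.EllipticCurves

/-! ## §1 One side, ambient subgroup as a parameter (defect-rank form of gk2-p3's count) -/

section OneSide

/-- **One-sided ladder count inside an arbitrary subgroup `Ш(X/ℚ) ≤ R ≤ H¹(ℚ, X)` of index `≤ 2^β`.**  For `X/ℚ` elliptic with
`Ш(X/ℚ)[2^∞]` finite of order `g`, and `R` with `[R : Ш(X/ℚ)] ≠ 0`, `≤ 2^β`: if for every `m < T` there are `2m+2` independent
elements of `R` of order `2^{e m}`, then `2 Σ_{m<T} e m ≤ ord₂ g + 2⌊β/2⌋` (count in `R[2^∞]`, `#R[2^∞] = k·g` with `k ∣ [R : Ш]`,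
Cassels–Tate parity refund).  gk2-p3 g18's `two_mul_sum_le_padicValNat_of_shaLadder` is the case `R = res⁻¹(Ш(X_K/K))`, `β = B`;
here `R := Ш(X/ℚ) ⊔ ⟨ladder⟩` makes `β` the 𝔽₂-rank of the ladder's genus defects. [cite: McCallumLMS1991, §5 Thm. 5.4]
[cite: SilvermanAEC2009, X.4.14] -/
theorem two_mul_sum_le_padicValNat_of_ladder_of_sha_le (X : WeierstrassCurve ℚ) [X.IsElliptic] {β : ℕ}
    (R : AddSubgroup X.galH1) (hR : X.sha ≤ R) (T : ℕ) (e : ℕ → ℕ)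
    (hg : 0 < Nat.card (AddCommGroup.primaryComponent X.sha 2))
    (hidx : (X.sha).relIndex R ≠ 0) (hle : (X.sha).relIndex R ≤ 2 ^ β)
    (hfam : ∀ m < T, ∃ x : Fin (2 * m + 2) → X.galH1, (∀ i, x i ∈ R) ∧ (∀ i, addOrderOf (x i) = 2 ^ e m) ∧
      ∀ c : Fin (2 * m + 2) → ℤ, ∑ i, c i • x i = 0 → ∀ i, ((2 ^ e m : ℕ) : ℤ) ∣ c i) :
    2 * ∑ m ∈ Finset.range T, e m ≤ padicValNat 2 (Nat.card (AddCommGroup.primaryComponent X.sha 2)) + 2 * (β / 2) := by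
  haveI : Finite (AddCommGroup.primaryComponent X.sha 2) := Nat.finite_of_card_ne_zero hg.ne'
  obtain ⟨k, hk, hkdvd, hcard⟩ := exists_natCard_primaryComponent_eq_mul_of_le hR 2 hidx
  have hkβ : k ≤ 2 ^ β := (Nat.le_of_dvd (Nat.pos_of_ne_zero hidx) hkdvd).trans hle
  have heven : Even (padicValNat 2 (Nat.card (AddCommGroup.primaryComponent X.sha 2))) :=
    even_padicValNat_of_isSquare hg.ne' (CasselsTateNumberField.isSquare_natCard_primaryComponent_sha X 2)
  refine two_mul_sum_le_padicValNat_add_of_ladder_of_dvd_mul_of_even (A := AddCommGroup.primaryComponent R 2) T e hg hk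
    hkβ (by rw [hcard]) heven fun m hm ↦ ?_
  obtain ⟨x, hmem, hord, hind⟩ := hfam m hm
  exact exists_indepFamily_primaryComponent_of_mem x hmem hord hind

/-- The relaxed group `res⁻¹(Ш(X_K/K))` contains `Ш(X/ℚ)` (restriction maps `Ш` to `Ш`). [folklore] -/
theorem sha_le_comap_resBaseChange_sha (X : WeierstrassCurve ℚ) (K : Type) [Field K] [NumberField K] :
    X.sha ≤ ((X.baseChange K).sha).comap (resBaseChange X K) :=
  fun _ hc ↦ AddSubgroup.mem_comap.mpr (resBaseChange_mem_sha X K hc)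

/-- **Intermediate subgroups inherit the budget**: for `H ≤ R₁ ≤ R` with `[R : H]` finite and `≤ b`, also `[R₁ : H]` is finite and
`≤ b` (`[R₁ : H] ∣ [R : H]`).  Use: `H = Ш(X/ℚ)`, `R = res⁻¹(Ш(X_K/K))`, `b = 2^{ord₂ C(Wd)}`, `R₁ = Ш(X/ℚ) ⊔ ⟨ladder⟩` — the defect
rank of any ladder is at most the genus budget. [folklore] -/
theorem relIndex_ne_zero_and_le_of_le_of_le {G : Type*} [AddGroup G] {H R₁ R : AddSubgroup G} (h₁ : H ≤ R₁) (h₂ : R₁ ≤ R)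
    {b : ℕ} (hne : H.relIndex R ≠ 0) (hle : H.relIndex R ≤ b) : H.relIndex R₁ ≠ 0 ∧ H.relIndex R₁ ≤ b := by
  have hmul := AddSubgroup.relIndex_mul_relIndex H R₁ R h₁ h₂
  have hdvd : H.relIndex R₁ ∣ H.relIndex R := ⟨_, hmul.symm⟩
  refine ⟨fun h0 ↦ hne ?_, (Nat.le_of_dvd (Nat.pos_of_ne_zero hne) hdvd).trans hle⟩
  rw [← hmul, h0, zero_mul]

end OneSide

/-! ## §2 The defect-rank frame (two sides, arbitrary intermediate subgroups) -/

section DefectRank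

variable (W : WeierstrassCurve ℚ) [W.IsElliptic] (Wd : WeierstrassCurve ℚ) [Wd.IsElliptic]

/-- **THE DEFECT-RANK FRAME.**  `W, Wd /ℚ` elliptic with `Ш(W/ℚ)[2^∞]`, `Ш(Wd/ℚ)[2^∞]` finite (orders `g, g′`); subgroups
`Ш(W/ℚ) ≤ R₊ ≤ H¹(ℚ, W)`, `Ш(Wd/ℚ) ≤ R₋ ≤ H¹(ℚ, Wd)` of finite indices `≤ 2^{β₊}`, `≤ 2^{β₋}`; an antitone ladder `M` with
`M (2T) = 0`, even-step families (`2m+2` independent classes of order `2^{M(2m) − M(2m+1)}`) in `R₊` and odd-step families (order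
`2^{M(2m+1) − M(2m+2)}`) in `R₋`.  Then `2·M₀ ≤ ord₂ g + ord₂ g′ + 2⌊β₊/2⌋ + 2⌊β₋/2⌋`.  With `R_± := Ш ⊔ ⟨ladder_±⟩` inside
`res⁻¹(Ш(·_K/K))`, `β_±` are the 𝔽₂-ranks of the two ladders' GENUS DEFECTS; on `ord₂ C(Wd) = 3` the registered 3a⁗
(`… + ord₂ C(Wd)`) follows as soon as `min(β₊, β₋) ≤ 1`.  No field `K`, no frame hypothesis is needed for the count itself.
[cite: McCallumLMS1991, §5 Thm. 5.4] [cite: Kramer1981, §4 (13)] -/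
theorem two_mul_le_padicValNat_add_of_ladders_of_sha_le {β₁ β₂ : ℕ}
    (R₁ : AddSubgroup W.galH1) (hR₁ : W.sha ≤ R₁) (hidx₁ : (W.sha).relIndex R₁ ≠ 0) (hle₁ : (W.sha).relIndex R₁ ≤ 2 ^ β₁)
    (R₂ : AddSubgroup Wd.galH1) (hR₂ : Wd.sha ≤ R₂) (hidx₂ : (Wd.sha).relIndex R₂ ≠ 0) (hle₂ : (Wd.sha).relIndex R₂ ≤ 2 ^ β₂)
    (hg : 0 < Nat.card (AddCommGroup.primaryComponent W.sha 2)) (hg' : 0 < Nat.card (AddCommGroup.primaryComponent Wd.sha 2))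
    (T : ℕ) (M : ℕ → ℕ) (hM : ∀ j, M (j + 1) ≤ M j) (hMT : M (2 * T) = 0)
    (hfam : ∀ m < T, ∃ x : Fin (2 * m + 2) → W.galH1, (∀ i, x i ∈ R₁) ∧
      (∀ i, addOrderOf (x i) = 2 ^ (M (2 * m) - M (2 * m + 1))) ∧
      ∀ c : Fin (2 * m + 2) → ℤ, ∑ i, c i • x i = 0 → ∀ i, ((2 ^ (M (2 * m) - M (2 * m + 1)) : ℕ) : ℤ) ∣ c i)
    (hfam' : ∀ m < T, ∃ x : Fin (2 * m + 2) → Wd.galH1, (∀ i, x i ∈ R₂) ∧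
      (∀ i, addOrderOf (x i) = 2 ^ (M (2 * m + 1) - M (2 * m + 2))) ∧
      ∀ c : Fin (2 * m + 2) → ℤ, ∑ i, c i • x i = 0 → ∀ i, ((2 ^ (M (2 * m + 1) - M (2 * m + 2)) : ℕ) : ℤ) ∣ c i) :
    2 * M 0 ≤ padicValNat 2 (Nat.card (AddCommGroup.primaryComponent W.sha 2)) +
      padicValNat 2 (Nat.card (AddCommGroup.primaryComponent Wd.sha 2)) + 2 * (β₁ / 2) + 2 * (β₂ / 2) := by
  have h₁ := two_mul_sum_le_padicValNat_of_ladder_of_sha_le W R₁ hR₁ T (fun m ↦ M (2 * m) - M (2 * m + 1)) hg hidx₁ hle₁ hfam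
  have h₂ := two_mul_sum_le_padicValNat_of_ladder_of_sha_le Wd R₂ hR₂ T (fun m ↦ M (2 * m + 1) - M (2 * m + 2)) hg' hidx₂
    hle₂ hfam'
  have hsum : 2 * ∑ m ∈ Finset.range T, (M (2 * m) - M (2 * m + 1)) +
      2 * ∑ m ∈ Finset.range T, (M (2 * m + 1) - M (2 * m + 2)) =
      2 * ∑ j ∈ Finset.range (2 * T), (M j - M (j + 1)) := by
    rw [sum_range_two_mul (fun j => M j - M (j + 1)), ← mul_add, ← Finset.sum_add_distrib]
  rw [sum_range_sub_eq_of_antitone M hM, hMT, Nat.sub_zero] at hsum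
  omega

/-- **3a⁗'s inequality from two ladders of small defect rank.**  Same data; if the two defect budgets satisfy
`2⌊β₊/2⌋ + 2⌊β₋/2⌋ ≤ ord₂ C(Wd)` — e.g. `ord₂ C(Wd) = 3` and `min(β₊, β₋) ≤ 1` with `β₊, β₋ ≤ 3` — then
`2·M₀ ≤ ord₂ g + ord₂ g′ + ord₂ C(Wd)`, the conclusion of the registered crux stub 3a⁗ `stub_twinExhibitionGenus`.
[cite: McCallumLMS1991, §5 Thm. 5.4] [cite: Kramer1981, §4 (13)] -/
theorem twinExhibitionGenus_ineq_of_ladders_of_sha_le {β₁ β₂ : ℕ}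
    (R₁ : AddSubgroup W.galH1) (hR₁ : W.sha ≤ R₁) (hidx₁ : (W.sha).relIndex R₁ ≠ 0) (hle₁ : (W.sha).relIndex R₁ ≤ 2 ^ β₁)
    (R₂ : AddSubgroup Wd.galH1) (hR₂ : Wd.sha ≤ R₂) (hidx₂ : (Wd.sha).relIndex R₂ ≠ 0) (hle₂ : (Wd.sha).relIndex R₂ ≤ 2 ^ β₂)
    (hβ : 2 * (β₁ / 2) + 2 * (β₂ / 2) ≤ padicValNat 2 Wd.tamagawaProduct)
    (hg : 0 < Nat.card (AddCommGroup.primaryComponent W.sha 2)) (hg' : 0 < Nat.card (AddCommGroup.primaryComponent Wd.sha 2))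
    (T : ℕ) (M : ℕ → ℕ) (hM : ∀ j, M (j + 1) ≤ M j) (hMT : M (2 * T) = 0)
    (hfam : ∀ m < T, ∃ x : Fin (2 * m + 2) → W.galH1, (∀ i, x i ∈ R₁) ∧
      (∀ i, addOrderOf (x i) = 2 ^ (M (2 * m) - M (2 * m + 1))) ∧
      ∀ c : Fin (2 * m + 2) → ℤ, ∑ i, c i • x i = 0 → ∀ i, ((2 ^ (M (2 * m) - M (2 * m + 1)) : ℕ) : ℤ) ∣ c i)
    (hfam' : ∀ m < T, ∃ x : Fin (2 * m + 2) → Wd.galH1, (∀ i, x i ∈ R₂) ∧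
      (∀ i, addOrderOf (x i) = 2 ^ (M (2 * m + 1) - M (2 * m + 2))) ∧
      ∀ c : Fin (2 * m + 2) → ℤ, ∑ i, c i • x i = 0 → ∀ i, ((2 ^ (M (2 * m + 1) - M (2 * m + 2)) : ℕ) : ℤ) ∣ c i) :
    (2 * M 0 : ℤ) ≤ (padicValNat 2 (Nat.card (AddCommGroup.primaryComponent W.sha 2)) : ℤ) +
      (padicValNat 2 (Nat.card (AddCommGroup.primaryComponent Wd.sha 2)) : ℤ) + (padicValNat 2 Wd.tamagawaProduct : ℤ) := by
  have h := two_mul_le_padicValNat_add_of_ladders_of_sha_le W Wd R₁ hR₁ hidx₁ hle₁ R₂ hR₂ hidx₂ hle₂ hg hg' T M hM hMT hfam hfam'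
  omega

end DefectRank

/-! ## §3 One-sided exhibition on the LINE 18 frame closes every `B` -/

section OneSidedFrame

variable (W : WeierstrassCurve ℚ) [W.IsElliptic] [W.IsGloballyMinimal] (K : Type) [Field K] [NumberField K]
  {Wd : WeierstrassCurve ℚ} [Wd.IsElliptic]

/-- **A one-sided total ladder in `H¹(ℚ, X)`, general `X`**: `Ш(X/ℚ)[2^∞]` finite, `[res⁻¹(Ш(X_K/K)) : Ш(X/ℚ)] ≤ 2^B` finite,
antitone `N` with `N T = 0`, and for each `j < T` an independent family of `2j+2` classes of order `2^{N j − N (j+1)}` restricting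
into `Ш(X_K/K)` ⟹ `2·N 0 ≤ ord₂ #Ш(X/ℚ)[2^∞] + 2⌊B/2⌋`. [cite: McCallumLMS1991, §5 Thm. 5.4] -/
theorem two_mul_le_padicValNat_of_oneSided_shaLadder (X : WeierstrassCurve ℚ) [X.IsElliptic] {B : ℕ}
    (hg : 0 < Nat.card (AddCommGroup.primaryComponent X.sha 2))
    (hidx : (X.sha).relIndex (((X.baseChange K).sha).comap (resBaseChange X K)) ≠ 0)
    (hle : (X.sha).relIndex (((X.baseChange K).sha).comap (resBaseChange X K)) ≤ 2 ^ B)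
    (T : ℕ) (N : ℕ → ℕ) (hN : ∀ j, N (j + 1) ≤ N j) (hNT : N T = 0)
    (hfam : ∀ j < T, ∃ x : Fin (2 * j + 2) → X.galH1, (∀ i, resBaseChange X K (x i) ∈ (X.baseChange K).sha) ∧
      (∀ i, addOrderOf (x i) = 2 ^ (N j - N (j + 1))) ∧
      ∀ c : Fin (2 * j + 2) → ℤ, ∑ i, c i • x i = 0 → ∀ i, ((2 ^ (N j - N (j + 1)) : ℕ) : ℤ) ∣ c i) :
    2 * N 0 ≤ padicValNat 2 (Nat.card (AddCommGroup.primaryComponent X.sha 2)) + 2 * (B / 2) := by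
  have h := two_mul_sum_le_padicValNat_of_shaLadder K X T (fun j ↦ N j - N (j + 1)) hg hidx hle hfam
  rwa [sum_range_sub_eq_of_antitone N hN, hNT, Nat.sub_zero] at h

/-- **ONE-SIDED EXHIBITION ON THE `W` SIDE CLOSES EVERY `B`.**  LINE 18 frame: `W/ℚ` globally minimal elliptic, `Δ_W < 0`,
`C(W)` odd; `K` imaginary quadratic, `d_K` odd, Heegner for `N_W`; `Wd = Cd • W^{(d_K)}`; `Ш(W/ℚ)[2^∞]`, `Ш(Wd/ℚ)[2^∞]` finite of orders
`g, g′`.  If the WHOLE ladder (`N` antitone, `N T = 0`, `2j+2` independent classes of order `2^{N j − N (j+1)}` at rung `j`) lies in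
`H¹(ℚ, W)` with restrictions in `Ш(W_K/K)`, then `2·N 0 ≤ ord₂ g + ord₂ g′ + ord₂ C(Wd) − 1` (3a‴; 3a⁗ a fortiori): the budget
`[res⁻¹Ш(W_K) : Ш(W)] ≤ 2^{ord₂ C(Wd)}` is paid once, Cassels–Tate parity and GP (`ord₂ C(Wd)` odd) give `2⌊B/2⌋ = B − 1`.
[cite: McCallumLMS1991, §5 Prop. 5.2, Thm. 5.4] [cite: Kramer1981, §2 Prop. 3, Thm. 1] -/
theorem twinExhibitionGenus_ineq_of_oneSided_shaLadder_W (hΔ : W.Δ < 0) (hT : Odd W.tamagawaProduct)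
    (hIQ : IsImaginaryQuadratic K) (hodd : Odd (NumberField.discr K)) (hHe : SatisfiesHeegnerHypothesis (W.conductorNorm ℤ) K)
    (Cd : VariableChange ℚ) (hWd : Cd • W.quadraticTwist (NumberField.discr K : ℚ) = Wd)
    (hg : 0 < Nat.card (AddCommGroup.primaryComponent W.sha 2))
    (T : ℕ) (N : ℕ → ℕ) (hN : ∀ j, N (j + 1) ≤ N j) (hNT : N T = 0)
    (hfam : ∀ j < T, ∃ x : Fin (2 * j + 2) → W.galH1, (∀ i, resBaseChange W K (x i) ∈ (W.baseChange K).sha) ∧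
      (∀ i, addOrderOf (x i) = 2 ^ (N j - N (j + 1))) ∧
      ∀ c : Fin (2 * j + 2) → ℤ, ∑ i, c i • x i = 0 → ∀ i, ((2 ^ (N j - N (j + 1)) : ℕ) : ℤ) ∣ c i) :
    (2 * N 0 : ℤ) ≤ (padicValNat 2 (Nat.card (AddCommGroup.primaryComponent W.sha 2)) : ℤ) +
      (padicValNat 2 (Nat.card (AddCommGroup.primaryComponent Wd.sha 2)) : ℤ) +
      (padicValNat 2 Wd.tamagawaProduct : ℤ) - 1 := by
  obtain ⟨hne, hle⟩ :=
    relIndex_sha_comap_resBaseChange_le_two_pow_padicValNat_tamagawaProduct_twin_of_Δ_neg W K hΔ hIQ hodd hHe hT Cd hWd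
  have h := two_mul_le_padicValNat_of_oneSided_shaLadder K W hg hne hle T N hN hNT hfam
  obtain ⟨r, hr⟩ := odd_padicValNat_two_tamagawaProduct_twin_of_Δ_neg W hIQ hodd hHe hT hΔ Cd hWd
  rw [hr] at h ⊢
  -- no `push_cast` (it would turn `((padicValNat 2 n : ℕ) : ℤ)` into `padicValRat`); `omega` sees through the casts
  omega

/-- **ONE-SIDED EXHIBITION ON THE TWIN SIDE CLOSES EVERY `B`.**  Same frame; the whole ladder in `H¹(ℚ, Wd)` with
restrictions in `Ш(Wd_K/K)` ⟹ `2·N 0 ≤ ord₂ g + ord₂ g′ + ord₂ C(Wd) − 1` (twin budget `relIndex_sha_comap_resBaseChange_twin_le_two_pow`).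
[cite: McCallumLMS1991, §5 Prop. 5.2, Thm. 5.4] [cite: Kramer1981, §2 Prop. 3, Thm. 1] -/
theorem twinExhibitionGenus_ineq_of_oneSided_shaLadder_Wd (hΔ : W.Δ < 0) (hT : Odd W.tamagawaProduct)
    (hIQ : IsImaginaryQuadratic K) (hodd : Odd (NumberField.discr K)) (hHe : SatisfiesHeegnerHypothesis (W.conductorNorm ℤ) K)
    (Cd : VariableChange ℚ) (hWd : Cd • W.quadraticTwist (NumberField.discr K : ℚ) = Wd)
    (hg' : 0 < Nat.card (AddCommGroup.primaryComponent Wd.sha 2))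
    (T : ℕ) (N : ℕ → ℕ) (hN : ∀ j, N (j + 1) ≤ N j) (hNT : N T = 0)
    (hfam' : ∀ j < T, ∃ x : Fin (2 * j + 2) → Wd.galH1, (∀ i, resBaseChange Wd K (x i) ∈ (Wd.baseChange K).sha) ∧
      (∀ i, addOrderOf (x i) = 2 ^ (N j - N (j + 1))) ∧
      ∀ c : Fin (2 * j + 2) → ℤ, ∑ i, c i • x i = 0 → ∀ i, ((2 ^ (N j - N (j + 1)) : ℕ) : ℤ) ∣ c i) :
    (2 * N 0 : ℤ) ≤ (padicValNat 2 (Nat.card (AddCommGroup.primaryComponent W.sha 2)) : ℤ) +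
      (padicValNat 2 (Nat.card (AddCommGroup.primaryComponent Wd.sha 2)) : ℤ) +
      (padicValNat 2 Wd.tamagawaProduct : ℤ) - 1 := by
  obtain ⟨hne, hle⟩ := relIndex_sha_comap_resBaseChange_twin_le_two_pow W (K := K) hΔ hIQ hodd hHe hT Cd hWd
  have h := two_mul_le_padicValNat_of_oneSided_shaLadder K Wd hg' hne hle T N hN hNT hfam'
  obtain ⟨r, hr⟩ := odd_padicValNat_two_tamagawaProduct_twin_of_Δ_neg W hIQ hodd hHe hT hΔ Cd hWd
  rw [hr] at h ⊢
  -- no `push_cast` (it would turn `((padicValNat 2 n : ℕ) : ℤ)` into `padicValRat`); `omega` sees through the casts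
  omega

/-- **L's own format, all ODD-STEP drops zero ⟹ 3a‴.**  With the two-sided ladder of stub L (`M` antitone, `M (2T) = 0`, `W`-families
at even steps, `Wd`-families at odd steps) in which every odd step is flat (`M (2m+1) = M (2m+2)` for `m < T`: nothing is exhibited on
the twin side), the `W`-families alone form a one-sided ladder `N j := M (2j)` and `2·M₀ ≤ ord₂ g + ord₂ g′ + ord₂ C(Wd) − 1`.
The `Wd`-families are not needed (and not assumed). [cite: McCallumLMS1991, §5 Prop. 5.2, Thm. 5.4] -/
theorem twinExhibitionGenus_ineq_of_shaLadders_of_odd_steps_eq (hΔ : W.Δ < 0) (hT : Odd W.tamagawaProduct)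
    (hIQ : IsImaginaryQuadratic K) (hodd : Odd (NumberField.discr K)) (hHe : SatisfiesHeegnerHypothesis (W.conductorNorm ℤ) K)
    (Cd : VariableChange ℚ) (hWd : Cd • W.quadraticTwist (NumberField.discr K : ℚ) = Wd)
    (hg : 0 < Nat.card (AddCommGroup.primaryComponent W.sha 2))
    (T : ℕ) (M : ℕ → ℕ) (hM : ∀ j, M (j + 1) ≤ M j) (hMT : M (2 * T) = 0)
    (hflat : ∀ m < T, M (2 * m + 1) = M (2 * m + 2))
    (hfam : ∀ m < T, ∃ x : Fin (2 * m + 2) → W.galH1, (∀ i, resBaseChange W K (x i) ∈ (W.baseChange K).sha) ∧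
      (∀ i, addOrderOf (x i) = 2 ^ (M (2 * m) - M (2 * m + 1))) ∧
      ∀ c : Fin (2 * m + 2) → ℤ, ∑ i, c i • x i = 0 → ∀ i, ((2 ^ (M (2 * m) - M (2 * m + 1)) : ℕ) : ℤ) ∣ c i) :
    (2 * M 0 : ℤ) ≤ (padicValNat 2 (Nat.card (AddCommGroup.primaryComponent W.sha 2)) : ℤ) +
      (padicValNat 2 (Nat.card (AddCommGroup.primaryComponent Wd.sha 2)) : ℤ) +
      (padicValNat 2 Wd.tamagawaProduct : ℤ) - 1 := by
  -- the one-sided ladder `N j := M (2j)`: `N j − N (j+1) = M (2j) − M (2j+1)` by flatness of the odd step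
  have hstep : ∀ m < T, M (2 * m) - M (2 * m + 1) = M (2 * m) - M (2 * (m + 1)) := fun m hm ↦ by
    rw [show 2 * (m + 1) = 2 * m + 2 by ring, ← hflat m hm]
  refine twinExhibitionGenus_ineq_of_oneSided_shaLadder_W W K hΔ hT hIQ hodd hHe Cd hWd hg T (fun j ↦ M (2 * j))
    (fun j ↦ ?_) (by simpa using hMT) fun j hj ↦ ?_
  · calc M (2 * (j + 1)) = M (2 * j + 1 + 1) := by ring_nf
      _ ≤ M (2 * j + 1) := hM _
      _ ≤ M (2 * j) := hM _
  · obtain ⟨x, hres, hord, hind⟩ := hfam j hj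
    refine ⟨x, hres, fun i ↦ by rw [hord i, hstep j hj], fun c hc i ↦ ?_⟩
    rw [← hstep j hj]
    exact hind c hc i

/-- **L's own format, all EVEN-STEP drops zero ⟹ 3a‴.**  Every even step flat (`M (2m) = M (2m+1)` for `m < T`: nothing exhibited
on the `W` side); the `Wd`-families alone form the one-sided ladder `N j := M (2j+1)` (`N 0 = M 1 = M 0`) and
`2·M₀ ≤ ord₂ g + ord₂ g′ + ord₂ C(Wd) − 1`. [cite: McCallumLMS1991, §5 Prop. 5.2, Thm. 5.4] -/
theorem twinExhibitionGenus_ineq_of_shaLadders_of_even_steps_eq (hΔ : W.Δ < 0) (hT : Odd W.tamagawaProduct)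
    (hIQ : IsImaginaryQuadratic K) (hodd : Odd (NumberField.discr K)) (hHe : SatisfiesHeegnerHypothesis (W.conductorNorm ℤ) K)
    (Cd : VariableChange ℚ) (hWd : Cd • W.quadraticTwist (NumberField.discr K : ℚ) = Wd)
    (hg' : 0 < Nat.card (AddCommGroup.primaryComponent Wd.sha 2))
    (T : ℕ) (M : ℕ → ℕ) (hM : ∀ j, M (j + 1) ≤ M j) (hMT : M (2 * T) = 0)
    (hflat : ∀ m < T, M (2 * m) = M (2 * m + 1))
    (hfam' : ∀ m < T, ∃ x : Fin (2 * m + 2) → Wd.galH1, (∀ i, resBaseChange Wd K (x i) ∈ (Wd.baseChange K).sha) ∧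
      (∀ i, addOrderOf (x i) = 2 ^ (M (2 * m + 1) - M (2 * m + 2))) ∧
      ∀ c : Fin (2 * m + 2) → ℤ, ∑ i, c i • x i = 0 → ∀ i, ((2 ^ (M (2 * m + 1) - M (2 * m + 2)) : ℕ) : ℤ) ∣ c i) :
    (2 * M 0 : ℤ) ≤ (padicValNat 2 (Nat.card (AddCommGroup.primaryComponent W.sha 2)) : ℤ) +
      (padicValNat 2 (Nat.card (AddCommGroup.primaryComponent Wd.sha 2)) : ℤ) +
      (padicValNat 2 Wd.tamagawaProduct : ℤ) - 1 := by
  rcases Nat.eq_zero_or_pos T with rfl | hT0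
  · -- empty ladder: `M 0 = M (2·0) = 0`
    have h0 : M 0 = 0 := by simpa using hMT
    obtain ⟨r, hr⟩ := odd_padicValNat_two_tamagawaProduct_twin_of_Δ_neg W hIQ hodd hHe hT hΔ Cd hWd
    rw [h0, hr]
    omega
  -- the one-sided ladder `N j := M (2j+1)` on the twin side; `N (j+1) = M (2j+3) = M (2j+2)` by flatness of the even step `j+1`
  -- (for `j + 1 < T`), and at the top `N T = M (2T+1) ≤ M (2T) = 0`.
  have hN0 : M 1 = M 0 := by have := hflat 0 hT0; simpa using this.symm
  have hmono : ∀ a b, a ≤ b → M b ≤ M a := fun a b hab ↦ by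
    induction hab with
    | refl => exact le_rfl
    | step _ ih => exact (hM _).trans ih
  have hNT : M (2 * T + 1) = 0 := Nat.eq_zero_of_le_zero (hMT ▸ hM (2 * T))
  have hstep : ∀ m < T, M (2 * m + 1) - M (2 * m + 2) = M (2 * m + 1) - M (2 * (m + 1) + 1) := fun m hm ↦ by
    rcases Nat.lt_or_ge (m + 1) T with h | h
    · rw [← hflat (m + 1) h, show 2 * (m + 1) = 2 * m + 2 by ring]
    · -- `m + 1 = T`: both `M (2m+2) = M (2T)` and `M (2T+1)` vanish
      have hm1 : m + 1 = T := le_antisymm hm h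
      have h2 : M (2 * m + 2) = 0 := by rw [show 2 * m + 2 = 2 * T by omega]; exact hMT
      have h3 : M (2 * (m + 1) + 1) = 0 := by rw [hm1]; exact hNT
      rw [h2, h3]
  have h := twinExhibitionGenus_ineq_of_oneSided_shaLadder_Wd W K hΔ hT hIQ hodd hHe Cd hWd hg' T (fun j ↦ M (2 * j + 1))
    (fun j ↦ hmono _ _ (by omega)) hNT fun j hj ↦ ?_
  · rw [hN0] at h
    exact h
  · obtain ⟨x, hres, hord, hind⟩ := hfam' j hj
    refine ⟨x, hres, fun i ↦ by rw [hord i, hstep j hj], fun c hc i ↦ ?_⟩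
    rw [← hstep j hj]
    exact hind c hc i

end OneSidedFrame

end Summit.BirchSwinnertonDyer.BirchSwinnertonDyer.Theorems.GenusExact.PlusDescent

end
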